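import Summits.BirchSwinnertonDyer.BirchSwinnertonDyer.Theorems.EisensteinDepletionAtTwoFamily81517Rank3Cert
import HarnessLib

/-!
# Parametric rank-`3` certificates on the `8-15-17` family (planner p2 GEN 39, part 2; landed by lead star-p1 GEN 14)

Sequel to `Theorems/EisensteinDepletionAtTwoFamily81517Rank3Cert.lean` (member `(337, 120)`):
the PARAMETRIC kernel — a rational point `(ℓ t², y)` on `E' = E_{34q, 225mq}` with `ℓ` prime,
`ℓ ∉ {m, q}`, gives `#α'(E'(ℚ)) ≥ 8`, hence (with the planted `#α ≥ 4`) `rank ≥ 3` — and two more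
odd door members attaining the door's predicted `3`: `(1741, 120)` and `(1912, 480)` (third points from
PARI `ellrank`, kit job j321661; each instance = one `norm_num` point check + three primality checks).
No new axioms; rc 0, 0 sorries. BSD is not proved by this file.
-/

set_option linter.dupNamespace false
set_option autoImplicit false

namespace Summit.BirchSwinnertonDyer.BirchSwinnertonDyer.Theorems.Family81517Rank3CertParametric

open scoped Classical
open _root_.WeierstrassCurve
open _root_.WeierstrassCurve.Affine (SqUnits sqClass sqClass_mul sqClass_sq sqClass_eq_one_iff)
open Literature.NumberTheory.EllipticCurves
open Summit.BirchSwinnertonDyer.Rank2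
open Summit.BirchSwinnertonDyer.BirchSwinnertonDyer.Theorems.Family81517Rank3Cert
  (squarefree_of_natAbs_eq_mul squarefree_of_natAbs_eq_mul₃ squarefree_of_natAbs_eq_prime
    sqClass_mem_range_of_eq)

/-! ## Parametric version: a third point `(ℓ t², y)` on `E'`, `ℓ` prime, `ℓ ∉ {m, q}` -/

section Parametric

variable {m q r : ℕ} {n : ℤ}

/-- **Eight classes from a third point of the shape `x = ℓ t²`.** For a member (`m, q, r` prime,
`q = m + 64n²`, `r = m + 289n²`, `n ≠ 0`) and a rational point `(ℓ t², y)` of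
`E' : y² = x³ + 34q x² + 225 m q x` with `ℓ` prime, `ℓ ≠ m`, `ℓ ≠ q`, `t ≠ 0`, the classes of the
eight squarefree integers `{1, mq, −q, −m, ℓ, ℓmq, −ℓq, −ℓm}` lie in `α'(E'(ℚ))` (from `O`, `T'`,
`Q₁ = (−25q, 600nq)`, the third point, and products). [folklore: Silverman–Tate §3.5–3.6] -/
theorem eight_classes_of_point' (hm : m.Prime) (hq : q.Prime) (hr : r.Prime) (hn : n ≠ 0)
    (hq_eq : (q : ℤ) = m + 64 * n ^ 2) (hr_eq : (r : ℤ) = m + 289 * n ^ 2)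
    {ℓ : ℕ} (hℓ : ℓ.Prime) (hℓm : ℓ ≠ m) (hℓq : ℓ ≠ q) {t : ℤ} (ht : t ≠ 0) {y : ℚ}
    (hy : y ^ 2 = ((((ℓ : ℤ) * t ^ 2 : ℤ)) : ℚ) ^ 3 + (((34 * q : ℤ)) : ℚ) * ((((ℓ : ℤ) * t ^ 2 : ℤ)) : ℚ) ^ 2 +
      (((225 * m * q : ℤ)) : ℚ) * ((((ℓ : ℤ) * t ^ 2 : ℤ)) : ℚ))
    (hcard : ({1, (m : ℤ) * q, -(q : ℤ), -(m : ℤ), (ℓ : ℤ), (ℓ : ℤ) * m * q, -((ℓ : ℤ) * q),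
      -((ℓ : ℤ) * m)} : Finset ℤ).card = 8) :
    ∃ S : Finset (SqUnits ℚ), (S : Set (SqUnits ℚ)) ⊆
      Set.range (⟨0, ((34 * q : ℤ) : ℚ), 0, ((225 * m * q : ℤ) : ℚ), 0⟩ : WeierstrassCurve ℚ).xSqClass ∧
        S.card = 8 := by
  haveI := isElliptic_mk_of_ne_zero (F := ℚ) (family81517_hab' hm hq hr hq_eq hr_eq)
  set W := (⟨0, ((34 * q : ℤ) : ℚ), 0, ((225 * m * q : ℤ) : ℚ), 0⟩ : WeierstrassCurve ℚ) with hW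
  obtain ⟨_, hmq⟩ := family81517_ne hn hq_eq hr_eq
  have hq0 : (q : ℤ) ≠ 0 := by exact_mod_cast hq.ne_zero
  have hm0 : (m : ℤ) ≠ 0 := by exact_mod_cast hm.ne_zero
  have hℓ0 : (ℓ : ℤ) ≠ 0 := by exact_mod_cast hℓ.ne_zero
  -- the generators
  have hs1 : sqClass (((1 : ℤ)) : ℚ) ∈ Set.range W.xSqClass := by
    refine ⟨0, ?_⟩
    rw [xSqClass_zero, Int.cast_one]
    exact ((sqClass_eq_one_iff one_ne_zero).mpr ⟨1, by norm_num⟩).symm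
  have hT : sqClass ((((m : ℤ) * q : ℤ)) : ℚ) ∈ Set.range W.xSqClass := by
    refine ⟨W.twoTorsionPoint, ?_⟩
    rw [xSqClass_twoTorsionPoint]
    show sqClass ((((225 * m * q : ℤ)) : ℚ)) = _
    rw [show (225 * m * q : ℤ) = ((m : ℤ) * q) * 15 ^ 2 by ring,
      sqClass_mul_sq_intCast (mul_ne_zero hm0 hq0) (by norm_num)]
  have hQ1 : sqClass (((-(q : ℤ) : ℤ)) : ℚ) ∈ Set.range W.xSqClass := by
    have hpt : (600 * n * q : ℤ) ^ 2 =
        (-(q : ℤ) * 5 ^ 2) ^ 3 + (34 * q) * (-(q : ℤ) * 5 ^ 2) ^ 2 + (225 * m * q) * (-(q : ℤ) * 5 ^ 2) := by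
      linear_combination (-5625 : ℤ) * q ^ 2 * hq_eq
    have h := sqClass_mem_range_of_eq (a := (((34 * q : ℤ)) : ℚ)) (b := (((225 * m * q : ℤ)) : ℚ))
      (x := (((-(q : ℤ) * 5 ^ 2 : ℤ)) : ℚ)) (y := (((600 * n * q : ℤ)) : ℚ)) (by exact_mod_cast hpt)
      (by exact_mod_cast mul_ne_zero (neg_ne_zero.mpr hq0) (by norm_num))
    rwa [sqClass_mul_sq_intCast (neg_ne_zero.mpr hq0) (by norm_num)] at h
  have hQ3 : sqClass (((ℓ : ℤ) : ℤ) : ℚ) ∈ Set.range W.xSqClass := by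
    have h := sqClass_mem_range_of_eq (a := (((34 * q : ℤ)) : ℚ)) (b := (((225 * m * q : ℤ)) : ℚ))
      (x := ((((ℓ : ℤ) * t ^ 2 : ℤ)) : ℚ)) (y := y) hy
      (by exact_mod_cast mul_ne_zero hℓ0 (pow_ne_zero 2 ht))
    rwa [sqClass_mul_sq_intCast hℓ0 ht] at h
  -- products
  have hmul : ∀ {d₁ d₂ : ℤ}, d₁ ≠ 0 → d₂ ≠ 0 → sqClass ((d₁ : ℤ) : ℚ) ∈ Set.range W.xSqClass →
      sqClass ((d₂ : ℤ) : ℚ) ∈ Set.range W.xSqClass →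
        sqClass (((d₁ * d₂ : ℤ)) : ℚ) ∈ Set.range W.xSqClass := by
    intro d₁ d₂ h₁ h₂ hm₁ hm₂
    have h := mul_mem_range_xSqClass W hm₁ hm₂
    rwa [← sqClass_mul (by exact_mod_cast h₁) (by exact_mod_cast h₂), ← Int.cast_mul] at h
  have hTQ1 : sqClass (((-(m : ℤ) : ℤ)) : ℚ) ∈ Set.range W.xSqClass := by
    have h := hmul (mul_ne_zero hm0 hq0) (neg_ne_zero.mpr hq0) hT hQ1
    rwa [show (((m : ℤ) * q) * (-(q : ℤ)) : ℤ) = (-(m : ℤ)) * (q : ℤ) ^ 2 by ring,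
      sqClass_mul_sq_intCast (neg_ne_zero.mpr hm0) hq0] at h
  have hTQ3 : sqClass ((((ℓ : ℤ) * m * q : ℤ)) : ℚ) ∈ Set.range W.xSqClass := by
    have h := hmul hℓ0 (mul_ne_zero hm0 hq0) hQ3 hT
    rwa [show ((ℓ : ℤ) * ((m : ℤ) * q) : ℤ) = (ℓ : ℤ) * m * q by ring] at h
  have hQ1Q3 : sqClass (((-((ℓ : ℤ) * q) : ℤ)) : ℚ) ∈ Set.range W.xSqClass := by
    have h := hmul hℓ0 (neg_ne_zero.mpr hq0) hQ3 hQ1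
    rwa [show ((ℓ : ℤ) * (-(q : ℤ)) : ℤ) = -((ℓ : ℤ) * q) by ring] at h
  have hTQ1Q3 : sqClass (((-((ℓ : ℤ) * m) : ℤ)) : ℚ) ∈ Set.range W.xSqClass := by
    have h := hmul hℓ0 (neg_ne_zero.mpr hm0) hQ3 hTQ1
    rwa [show ((ℓ : ℤ) * (-(m : ℤ)) : ℤ) = -((ℓ : ℤ) * m) by ring] at h
  -- squarefreeness of the eight representatives
  have hsqf : ∀ d ∈ ({1, (m : ℤ) * q, -(q : ℤ), -(m : ℤ), (ℓ : ℤ), (ℓ : ℤ) * m * q, -((ℓ : ℤ) * q),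
      -((ℓ : ℤ) * m)} : Finset ℤ), Squarefree d := by
    intro d hd
    simp only [Finset.mem_insert, Finset.mem_singleton] at hd
    rcases hd with rfl | rfl | rfl | rfl | rfl | rfl | rfl | rfl
    · exact squarefree_one
    · exact squarefree_intCast_mul_of_prime hm hq hmq
    · exact squarefree_neg_intCast_of_prime hq
    · exact squarefree_neg_intCast_of_prime hm
    · exact squarefree_of_natAbs_eq_prime (p := ℓ) (by simp) hℓ
    · exact squarefree_of_natAbs_eq_mul₃ (p₁ := ℓ) (p₂ := m) (p₃ := q)
        (by simp [Int.natAbs_mul]) hℓ hm hq hℓm hℓq hmq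
    · exact squarefree_of_natAbs_eq_mul (p₁ := ℓ) (p₂ := q) (by simp [Int.natAbs_mul]) hℓ hq hℓq
    · exact squarefree_of_natAbs_eq_mul (p₁ := ℓ) (p₂ := m) (by simp [Int.natAbs_mul]) hℓ hm hℓm
  have hsub : (↑(({1, (m : ℤ) * q, -(q : ℤ), -(m : ℤ), (ℓ : ℤ), (ℓ : ℤ) * m * q, -((ℓ : ℤ) * q),
      -((ℓ : ℤ) * m)} : Finset ℤ).image fun d : ℤ => sqClass (d : ℚ)) : Set (SqUnits ℚ)) ⊆
        Set.range W.xSqClass := by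
    intro c hc
    obtain ⟨d, hd, rfl⟩ := Finset.mem_image.mp (Finset.mem_coe.mp hc)
    simp only [Finset.mem_insert, Finset.mem_singleton] at hd
    rcases hd with rfl | rfl | rfl | rfl | rfl | rfl | rfl | rfl
    · exact hs1
    · exact hT
    · exact hQ1
    · exact hTQ1
    · exact hQ3
    · exact hTQ3
    · exact hQ1Q3
    · exact hTQ1Q3
  refine ⟨({1, (m : ℤ) * q, -(q : ℤ), -(m : ℤ), (ℓ : ℤ), (ℓ : ℤ) * m * q, -((ℓ : ℤ) * q),
    -((ℓ : ℤ) * m)} : Finset ℤ).image fun d : ℤ => sqClass (d : ℚ), hsub, ?_⟩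
  rw [Finset.card_image_of_injOn (fun d₁ h₁ d₂ h₂ he =>
    eq_of_sqClass_intCast_eq (hsqf d₁ h₁) (hsqf d₂ h₂) he)]
  exact hcard

/-- **Rank `≥ 3` from a third point `(ℓ t², y)` on `E'`** (normal-form model
`E : y² = x³ − 17q x² + 16 q r x`): `#α ≥ 4` (planted, tree) and `#α' ≥ 8` give `2 + 3 ≤ rank + 2`.
[folklore: Silverman–Tate §3.6] -/
theorem three_le_mordellWeilRank_of_point' (hm : m.Prime) (hq : q.Prime) (hr : r.Prime) (hn : n ≠ 0)
    (hq_eq : (q : ℤ) = m + 64 * n ^ 2) (hr_eq : (r : ℤ) = m + 289 * n ^ 2)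
    {ℓ : ℕ} (hℓ : ℓ.Prime) (hℓm : ℓ ≠ m) (hℓq : ℓ ≠ q) {t : ℤ} (ht : t ≠ 0) {y : ℚ}
    (hy : y ^ 2 = ((((ℓ : ℤ) * t ^ 2 : ℤ)) : ℚ) ^ 3 + (((34 * q : ℤ)) : ℚ) * ((((ℓ : ℤ) * t ^ 2 : ℤ)) : ℚ) ^ 2 +
      (((225 * m * q : ℤ)) : ℚ) * ((((ℓ : ℤ) * t ^ 2 : ℤ)) : ℚ))
    (hcard : ({1, (m : ℤ) * q, -(q : ℤ), -(m : ℤ), (ℓ : ℤ), (ℓ : ℤ) * m * q, -((ℓ : ℤ) * q),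
      -((ℓ : ℤ) * m)} : Finset ℤ).card = 8) :
    3 ≤ (⟨0, ((-17 * q : ℤ) : ℚ), 0, ((16 * q * r : ℤ) : ℚ), 0⟩ : WeierstrassCurve ℚ).mordellWeilRank := by
  haveI := isElliptic_family81517 hm hq hr hq_eq hr_eq
  obtain ⟨S, hS, hS4⟩ := family81517_four_classes hm hq hr hn hq_eq hr_eq
  obtain ⟨S', hS', hS8⟩ := eight_classes_of_point' hm hq hr hn hq_eq hr_eq hℓ hℓm hℓq ht hy hcard
  rw [← family81517_codomain hq_eq hr_eq] at hS'
  have h := add_le_mordellWeilRank_add_two_of_card_le _ hS hS' (i := 2) (j := 3)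
    (by rw [hS4]; norm_num) (by rw [hS8]; norm_num)
  omega

/-- **The same on the family's `a₁ = 1` model** `⟨1, A, 0, qr, 0⟩`, `4A = −17q − 1` (change of
variables `(2, 0, 1, 0)`, tree `variableChange_family81517` + `mordellWeilRank_variableChange_holds`).
[folklore: AEC III.3.1(b)] -/
theorem three_le_mordellWeilRank_model_of_point' (hm : m.Prime) (hq : q.Prime) (hr : r.Prime)
    (hn : n ≠ 0) (hq_eq : (q : ℤ) = m + 64 * n ^ 2) (hr_eq : (r : ℤ) = m + 289 * n ^ 2)
    {ℓ : ℕ} (hℓ : ℓ.Prime) (hℓm : ℓ ≠ m) (hℓq : ℓ ≠ q) {t : ℤ} (ht : t ≠ 0) {y : ℚ}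
    (hy : y ^ 2 = ((((ℓ : ℤ) * t ^ 2 : ℤ)) : ℚ) ^ 3 + (((34 * q : ℤ)) : ℚ) * ((((ℓ : ℤ) * t ^ 2 : ℤ)) : ℚ) ^ 2 +
      (((225 * m * q : ℤ)) : ℚ) * ((((ℓ : ℤ) * t ^ 2 : ℤ)) : ℚ))
    (hcard : ({1, (m : ℤ) * q, -(q : ℤ), -(m : ℤ), (ℓ : ℤ), (ℓ : ℤ) * m * q, -((ℓ : ℤ) * q),
      -((ℓ : ℤ) * m)} : Finset ℤ).card = 8) {A : ℤ} (hA : 4 * A = -17 * q - 1) :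
    3 ≤ (⟨1, (A : ℚ), 0, (((q : ℤ) * r : ℤ) : ℚ), 0⟩ : WeierstrassCurve ℚ).mordellWeilRank := by
  have key := three_le_mordellWeilRank_of_point' hm hq hr hn hq_eq hr_eq hℓ hℓm hℓq ht hy hcard
  set C : VariableChange ℚ := ⟨Units.mk0 (2 : ℚ) two_ne_zero, 0, 1, 0⟩ with hC
  set E : WeierstrassCurve ℚ := ⟨0, ((-17 * q : ℤ) : ℚ), 0, ((16 * q * r : ℤ) : ℚ), 0⟩ with hE
  have hinv : (C • E).mordellWeilRank = E.mordellWeilRank := mordellWeilRank_variableChange_holds E C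
  rw [hC, hE, variableChange_family81517 hA] at hinv
  rw [hinv]
  exact key

end Parametric

/-! ## Two more odd members via the parametric version -/

/-- **Odd member `(1741, 120)`** (`m = 13931`, `q = 935531`, `r = 4175531`): third point
`Q₃ = (5·941², 26893629440)` on `E'` (PARI j321661) ⇒ `3 ≤ rank`. [this file] -/
theorem oddMember_three_le_rank_1741_120 :
    Family81517.AdmissibleF 1741 120 ∧ Family81517.OddSign 1741 120 ∧
      3 ≤ (Family81517.curve 1741 120).mordellWeilRank := by
  have hm : (13931 : ℕ).Prime := by norm_num
  have hq : (935531 : ℕ).Prime := by norm_num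
  have hr : (4175531 : ℕ).Prime := by norm_num
  refine ⟨?_, ?_, ?_⟩
  · simp only [Family81517.AdmissibleF, Family81517.qOf, Family81517.rOf, Family81517.mOf]
    refine ⟨by norm_num, ?_, by norm_num, by norm_num, ?_, ?_⟩
    · exact Int.prime_iff_natAbs_prime.mpr (by norm_num)
    · exact Int.prime_iff_natAbs_prime.mpr (by norm_num)
    · exact Int.prime_iff_natAbs_prime.mpr (by norm_num)
  · simp only [Family81517.OddSign, Family81517.qOf]
    norm_num
  · have key := three_le_mordellWeilRank_model_of_point' (n := 120) hm hq hr (by norm_num)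
      (by norm_num) (by norm_num) (ℓ := 5) (by norm_num) (by norm_num) (by norm_num) (t := 941)
      (by norm_num) (y := 26893629440) (by push_cast; norm_num) (by decide) (A := -3976007)
      (by norm_num)
    have hcurve : Family81517.curve 1741 120 =
        ⟨1, ((-3976007 : ℤ) : ℚ), 0, ((((935531 : ℕ) : ℤ) * (4175531 : ℕ) : ℤ) : ℚ), 0⟩ := by
      simp only [Family81517.curve, Family81517.qOf, Family81517.rOf]
      norm_num
    rw [hcurve]
    exact key

/-- **Odd member `(1912, 480)`** (`m = 15299`, `q = 14760899`, `r = 66600899`): third point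
`Q₃ = (5·8967², 12088052585280)` on `E'` (PARI j321661) ⇒ `3 ≤ rank`. [this file] -/
theorem oddMember_three_le_rank_1912_480 :
    Family81517.AdmissibleF 1912 480 ∧ Family81517.OddSign 1912 480 ∧
      3 ≤ (Family81517.curve 1912 480).mordellWeilRank := by
  have hm : (15299 : ℕ).Prime := by norm_num
  have hq : (14760899 : ℕ).Prime := by norm_num
  have hr : (66600899 : ℕ).Prime := by norm_num
  refine ⟨?_, ?_, ?_⟩
  · simp only [Family81517.AdmissibleF, Family81517.qOf, Family81517.rOf, Family81517.mOf]
    refine ⟨by norm_num, ?_, by norm_num, by norm_num, ?_, ?_⟩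
    · exact Int.prime_iff_natAbs_prime.mpr (by norm_num)
    · exact Int.prime_iff_natAbs_prime.mpr (by norm_num)
    · exact Int.prime_iff_natAbs_prime.mpr (by norm_num)
  · simp only [Family81517.OddSign, Family81517.qOf]
    norm_num
  · have key := three_le_mordellWeilRank_model_of_point' (n := 480) hm hq hr (by norm_num)
      (by norm_num) (by norm_num) (ℓ := 5) (by norm_num) (by norm_num) (by norm_num) (t := 8967)
      (by norm_num) (y := 12088052585280) (by push_cast; norm_num) (by decide) (A := -62733821)
      (by norm_num)
    have hcurve : Family81517.curve 1912 480 =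
        ⟨1, ((-62733821 : ℤ) : ℚ), 0, ((((14760899 : ℕ) : ℤ) * (66600899 : ℕ) : ℤ) : ℚ), 0⟩ := by
      simp only [Family81517.curve, Family81517.qOf, Family81517.rOf]
      norm_num
    rw [hcurve]
    exact key

end Summit.BirchSwinnertonDyer.BirchSwinnertonDyer.Theorems.Family81517Rank3CertParametric
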